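import Summits.BirchSwinnertonDyer.Rank1Residual.X11b.Three.KolyvaginShaOrderThree
import Summits.BirchSwinnertonDyer.Rank1Residual.X11b.KolyvaginLeafInputsDischarged
import Literature.NumberTheory.GaloisCohomology.PoitouTateNumberField
import HarnessLib

/-!
# Kolyvagin's ORDER bound `ord_3 #Ш(E/K)[3^∞] ≤ 2 ord_3 [E(K) : ℤ y_K]` on the class
# X11b @ 3 ∩ (KN₃)/ℚ modulo ONE cite-only input `hγ` and the Cassels–Tate inputs
# (the ORDER ENDs at `3` with `hPT`, `hrec`, `hCM`, `h53` DISCHARGED)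

Cell `b2b-bsdres`, team x11b3 (N8/O2 = X11b @ 3); seat x11b3-p2 GEN 52 (unit claimed D-0075 →
BSD:K2/P4 «Kolyvagin-in-kernel»; ladder row P4 «Kolyvagin #Ш(E/K)[p^∞] ≤ p^{2M₀} incl. p = 3
relative to local-duality binders»).  Summit-side THEOREM-ONLY file (no definition, no named fact,
no `sorry`); `K : Type`.

HONEST FRAMING (cell `b2b-bsdres`, run/shared/lean/b2b/bsd-rank1-residual/, verbatim in every
file): the goal of the cell is to DELETE the COMBINATION-SHAPED residual classes of the
Birch–Swinnerton-Dyer formula for ALL analytic-rank `≤ 1` elliptic curves over `ℚ` — "full BSD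
formula for every rank `≤ 1` curve in class `C`" assembled STRICTLY from published theorems — so
that the rank-`≤ 1` remainder becomes exactly the CONSTRUCTION-SHAPED classes, which are TYPED
(missing-input `Prop`s), NOT attempted.  This is not "finishing BSD".  The X11b @ 3 class stays
OPEN; nothing here is booked; no mark / label / count / tier moves.

WHAT THIS FILE DOES.  The ORDER-form class ENDs at `3` of this seat's Kolyvagin telescope,
`Three.KolyvaginOrder.card_sha_three_primary_le_of_classX11b_of_kodairaNeron_rat_of_localDuality'`
(divisibility form `3^{M₀} x₀ = y_K ∉ 3^{M₀+1}E(K)`, `M₀ ≥ 1`) and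
`…_rat_index_of_localDuality` (printed Heegner-INDEX form, any `M₀ = ord_3 [E(K) : ℤ y_K]`)
(`Three/KolyvaginShaOrderThree`, DEAL #32 P5 p403726: McCallum 1991 §1 Theorem (Kolyvagin) at
`p = 3` — `Ш(E/K)[3^∞]` finite, killed by `3^{M₀}`, `#Ш(E/K)[3^∞] ≤ 3^{2M₀}`,
`ord_3 # ≤ 2M₀`) are CONDITIONAL on EXACTLY the five labelled cite-only inputs {`hPT`, `hrec`,
`hCM`, `h53`, `hγ`} at `3` + `hN` + (KN₃)/ℚ + the Cassels–Tate inputs at level `3^{M₀}` (the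
tree's own open inputs of `exists_casselsTate_pairing_of_inputs`: Weil pairing `e`, `inv`, `hH3`,
Milne I 6.13(a) `IsLevelPairing`, `Gal(K/ℚ)`-equivariance `hPτ`).  FOUR of the five labels are now
KERNEL THEOREMS of the tree (2026-08-27): `hPT = GaloisCohomology.poitouTate_sum_localTatePairing_eq_zero_holds K`,
`hrec = heegnerPointOfConductor_one_galoisConj_holds N W K`, `hCM = KolyvaginLeaves.hCM_holds N W K 3`,
`h53 = KolyvaginLeaves.h53_holds hN 3` (`X11b/KolyvaginLeafInputsDischarged`).  THIS FILE
re-issues both ENDs with those labels SUPPLIED — every other binder and the conclusion VERBATIM,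
proof = one application of the parent — so that Kolyvagin's order bound at `3` on X11b @ 3 ∩
(KN₃)/ℚ rests on EXACTLY ONE cite-only input at `3`, `hγ` = Gross 1991 Prop. 3.7 (2) (the
Eichler–Shimura congruence; not in the tree), plus the Cassels–Tate inputs.  Siblings:
`Three/KolyvaginShaThreeDischarged` (K-side finiteness / annihilator, no Cassels–Tate inputs),
`Three/KolyvaginShaThreeRatDischarged` (ℚ-side).  Nothing else is claimed; nothing booked.

## What is proved (namespace `Summit.BirchSwinnertonDyer.Rank1Residual.X11b.Three.KolyvaginDischarged`)

* `card_sha_three_primary_le_of_classX11b_of_kodairaNeron_rat_of_localDuality` — divisibility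
  form, `M₀ ≥ 1`: finite ∧ `3^{M₀}`-torsion ∧ `# ≤ 3^{2M₀}` ∧ `ord_3 # ≤ 2M₀`, modulo {`hγ`} +
  `hN` + (KN₃)/ℚ + Cassels–Tate inputs.
* `card_sha_three_primary_le_of_classX11b_of_kodairaNeron_rat_index_of_localDuality` — the
  printed Heegner-INDEX form `ord_3 #Ш(E/K)[3^∞] ≤ 2 ord_3 [E(K) : ℤ y_K]`, same inputs.

## References

* [McCallumLMS1991] W. G. McCallum, *Kolyvagin's work on Shafarevich–Tate groups*, LMS LNS 153
  (1991), §1 Theorem p. 296, Lemma 5.1 p. 303, Prop. 4.7, Lemma 5.3, Thm. 5.4, Cor. 5.6.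
* [GrossLMS1991] B. H. Gross, *Kolyvagin's work on modular elliptic curves*, same volume, Thm. 2.2
  (2), Prop. 2.1 (2), §3 Prop. 3.7 (2), Prop. 5.3, §10.
* [MilneADT2006] J. S. Milne, *Arithmetic Duality Theorems*, 2nd ed., I §6 Prop. 6.9, Thm. 6.13(a).
* [Serre1972] §2.4 Prop. 15; [SilvermanAEC2009] VII.6.1; [Darmon2004] Thm. 3.6, Thm. 3.7.

presearch: `lean search 'KolyvaginDischarged|of_localDuality_of_gamma'` → none; parents = the two
tree ENDs named above (this seat, GEN 41–42); dischargers = tree theorems of 2026-08-27 (see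
`X11b/KolyvaginLeafInputsDischarged`); [corpus:book:editornd-l-functions-arithmetic chunk 216
(Prop. 3.7)] for the remaining input; nothing minted.
-/

noncomputable section

namespace Summit.BirchSwinnertonDyer.Rank1Residual.X11b.Three.KolyvaginDischarged

open scoped Classical
open WeierstrassCurve Field NumberField IsDedekindDomain Function
open Literature.NumberTheory.EllipticCurves Literature.NumberTheory.GaloisRepresentations
open Literature.NumberTheory.EllipticCurves.Rank1Residual
open Literature.NumberTheory.EllipticCurves.RingClassField
open Literature.NumberTheory.EllipticCurves.ModularForms
open Literature.NumberTheory.DiophantineGeometry Literature.NumberTheory.DiophantineGeometry.TateAlgorithm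
open Literature.NumberTheory.GaloisCohomology
open Literature.NumberTheory.GaloisRepresentations.DiscreteGaloisModule (mu MuCarrier)

-- `LocallyCompactSpace Γ_K` / `CharZero` of completions, as in the tree's Cassels–Tate files.
attribute [local instance] absoluteGaloisGroup_compactSpace charZero_placeCompletion

variable {K : Type} [Field K] [NumberField K] {N : ℕ} {W : WeierstrassCurve ℚ}

/-- **On the class X11b @ 3 ∩ (KN₃)/ℚ: `ord_3 #Ш(E/K)[3^∞] ≤ 2M₀` — modulo ONE cite-only input
`hγ` at `3` and the Cassels–Tate inputs, NO image hypothesis** — for `3^{M₀} x₀ = y_K ∉ 3^{M₀+1}E(K)`,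
`M₀ ≥ 1`.  The tree END
`Three.KolyvaginOrder.card_sha_three_primary_le_of_classX11b_of_kodairaNeron_rat_of_localDuality'`
(FIVE labels) with `hPT`, `hrec`, `hCM`, `h53` SUPPLIED by `poitouTate_sum_localTatePairing_eq_zero_holds K`,
`heegnerPointOfConductor_one_galoisConj_holds N W K`, `KolyvaginLeaves.hCM_holds N W K 3`,
`KolyvaginLeaves.h53_holds hN 3`; every other binder (incl. the displayed Cassels–Tate inputs) and
the conclusion (finite ∧ `3^{M₀}`-torsion ∧ `# ≤ 3^{2M₀}` ∧ `ord_3 # ≤ 2M₀`) VERBATIM.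
CONDITIONAL on EXACTLY {`hγ`} at `3` (Gross Prop. 3.7 (2); cite-only, NOT discharged) + `hN` +
(KN₃)/ℚ + the Cassels–Tate inputs; nothing booked; no mark / count / tier moves.
[cite: McCallumLMS1991, §1 Theorem (Kolyvagin), Lemma 5.1, Cor. 5.6] [cite: GrossLMS1991, Thm. 2.2 (2), §3 Prop. 3.7 (2), §10]
[cite: MilneADT2006, Ch. I §6, Thm. 6.13(a)] [cite: Serre1972, §2.4 Prop. 15] -/
theorem card_sha_three_primary_le_of_classX11b_of_kodairaNeron_rat_of_localDuality [NeZero N]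
    [W.IsGloballyMinimal] (hW : ClassX11b W 3) (hN : ∀ [W.IsElliptic], N = W.conductorNorm ℤ)
    (hKN3m : ∀ [W.IsElliptic] (v : HeightOneSpectrum (𝓞 ℚ)),
      W.HasMultiplicativeReductionAt v → ¬ 3 ∣ W.ordMinimalDiscriminant v)
    (hKN3a : ∀ [W.IsElliptic] (v : HeightOneSpectrum (𝓞 ℚ)), W.HasAdditiveReductionAt v →
      W.kodairaSymbolAt v ≠ KodairaSymbol.IV ∧ W.kodairaSymbolAt v ≠ KodairaSymbol.IVstar)
    (hγ : ∀ [W.IsElliptic] (_hK : IsImaginaryQuadratic K) (_hH : SatisfiesHeegnerHypothesis N K)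
      (Dt : ModularParametrizationData W N) (β : ℤ) (ι : K →+* ℂ) {M : ℕ}
      (_hM : 1 ≤ M) {n : ℕ} (_hn : Squarefree n)
      (_hKol : ∀ q ∈ n.primeFactors, IsKolyvaginPrime N W K 3 q ∧ FrobEqFrobInfty W K (3 ^ M) q)
      (d : (m : ℕ) → m ∣ n → KolyvaginHeegnerData Dt β ι m)
      (m : ℕ) (hm : m ∣ n) (ℓ : ℕ) (hℓ : ℓ ∈ m.primeFactors) [Fact ℓ.Prime]
      (hΔ : ¬ (ℓ : ℤ) ∣ minimalDiscriminantInt W) (φ₀ : absoluteGaloisGroup (ZMod ℓ)),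
      (∀ x : AlgebraicClosure (ZMod ℓ), φ₀ • x = x ^ ℓ) →
      ∀ (hle : ringClassField K ι (m / ℓ) ≤ ringClassField K ι m)
        (γ : ringClassField K ι m ≃ₐ[ℚ] ringClassField K ι m), γ ∈ ringClassGal ι m →
        geomReduction hΔ ((RatClosure.pointsEquiv (K := K) W).symm
            ((d m hm).toGeomPoints (pointGalHom W (ringClassField K ι m) γ (d m hm).y))) =
          φ₀ • geomReduction hΔ ((RatClosure.pointsEquiv (K := K) W).symm
            ((d m hm).toGeomPoints (pointGalHom W (ringClassField K ι m) γ
              (WeierstrassCurve.Affine.Point.map (W' := W)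
                ((RingClassField.inclusion ι hle).restrictScalars ℚ)
                (d (m / ℓ)
                  ((Nat.div_dvd_of_dvd (Nat.dvd_of_mem_primeFactors hℓ)).trans hm)).y))))) :
    ∀ [W.IsElliptic] (_hK : IsImaginaryQuadratic K) (_hH : SatisfiesHeegnerHypothesis N K)
      {P : (W.baseChange K).toAffine.Point} (_hP : IsHeegnerPoint N W K P)
      (_hnt : ¬ IsOfFinAddOrder P)
      {M₀ : ℕ} (_hM₀ : 1 ≤ M₀) [NeZero (3 ^ M₀)] {c : K ≃ₐ[ℚ] K} (_hc : c ≠ 1) (_hcc : c * c = 1)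
      {x₀ : (W.baseChange K).toAffine.Point} (_hx₀ : 3 ^ M₀ • x₀ = P)
      (_hmax : ∀ Q : (W.baseChange K).toAffine.Point, 3 ^ (M₀ + 1) • Q ≠ P)
      (e : geomTorsion (W.baseChange K) ((3 ^ M₀ * 3 ^ M₀ : ℕ) : ℤ) →
        geomTorsion (W.baseChange K) ((3 ^ M₀ * 3 ^ M₀ : ℕ) : ℤ) → AlgebraicClosure K)
      (hμ : ∀ S T, e S T ^ (3 ^ M₀ * 3 ^ M₀) = 1)
      (hadd₁ : ∀ S₁ S₂ T, e (S₁ + S₂) T = e S₁ T * e S₂ T)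
      (hadd₂ : ∀ S T₁ T₂, e S (T₁ + T₂) = e S T₁ * e S T₂)
      (hgal : ∀ (σ : absoluteGaloisGroup K) (S T : geomTorsion (W.baseChange K) ((3 ^ M₀ * 3 ^ M₀ : ℕ) : ℤ)),
        σ • e S T = e (σ • S) (σ • T))
      (halt : ∀ T, e T T = 1) (hnondeg : ∀ T, (∀ S, e S T = 1) → T = 0)
      (inv : LocalInvariants K (3 ^ M₀ * 3 ^ M₀)) (hPT' : inv.SumInvLocalizationEqZero)
      (hinv : ∀ v : HeightOneSpectrum (𝓞 K), Injective (inv (Sum.inr v)))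
      (hH3 : ∀ x : galoisCohomology (mu K (3 ^ M₀ * 3 ^ M₀)) 3,
        (∀ v : Place K, galoisCohomology.localization (mu K (3 ^ M₀ * 3 ^ M₀)) v 3 x = 0) → x = 0)
      (hB : Literature.GroupTheory.FiniteAbelian.IsLevelPairing (3 ^ M₀)
        (ctLevelPairing (W.baseChange K) (3 ^ M₀) e hμ hadd₁ hadd₂ hgal inv halt hPT' hH3
          (localTerm_finite_support (W := W.baseChange K) (m := 3 ^ M₀) (e := e) (hμ := hμ)
            (hadd₁ := hadd₁) (hadd₂ := hadd₂) (hgal := hgal) halt inv)))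
      (hPτ : ∀ z ∈ selmerGroup (W.baseChange K) ((3 ^ M₀ * 3 ^ M₀ : ℕ) : ℤ),
        ∀ t ∈ selmerGroup (W.baseChange K) ((3 ^ M₀ * 3 ^ M₀ : ℕ) : ℤ),
        ctGeneralFun (W.baseChange K) (3 ^ M₀) e hμ hadd₁ hadd₂ hgal inv
            (torsionH1ToH1 (W.baseChange K) _ (conjAct W c _ z))
            (torsionH1ToH1 (W.baseChange K) _ (conjAct W c _ t)) =
          ctGeneralFun (W.baseChange K) (3 ^ M₀) e hμ hadd₁ hadd₂ hgal inv
            (torsionH1ToH1 (W.baseChange K) _ z) (torsionH1ToH1 (W.baseChange K) _ t)),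
      Finite (AddCommGroup.primaryComponent (W.baseChange K).sha 3) ∧
      (∀ c ∈ AddCommGroup.primaryComponent (W.baseChange K).sha 3, 3 ^ M₀ • c = 0) ∧
      Nat.card (AddCommGroup.primaryComponent (W.baseChange K).sha 3) ≤ 3 ^ (2 * M₀) ∧
      padicValNat 3 (Nat.card (AddCommGroup.primaryComponent (W.baseChange K).sha 3)) ≤ 2 * M₀ :=
  Three.KolyvaginOrder.card_sha_three_primary_le_of_classX11b_of_kodairaNeron_rat_of_localDuality'
    hW
    (poitouTate_sum_localTatePairing_eq_zero_holds K) hN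
    (heegnerPointOfConductor_one_galoisConj_holds N W K) (KolyvaginLeaves.hCM_holds N W K 3)
    (@fun _ ↦ KolyvaginLeaves.h53_holds hN 3) hKN3m hKN3a hγ

/-- **McCallum 1991 §1 Theorem (Kolyvagin) at `p = 3` on the class X11b @ 3 ∩ (KN₃)/ℚ, printed
Heegner-INDEX form: `ord_3 #Ш(E/K)[3^∞] ≤ 2 · ord_3 [E(K) : ℤ y_K]`** (for `[E(K) : ℤ y_K]` finite),
with `Ш(E/K)[3^∞]` finite, killed by `3^{M₀}`, of order `≤ 3^{2M₀}`, `M₀ = ord_3 [E(K) : ℤ y_K]` —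
modulo ONE cite-only input `hγ` at `3` and the Cassels–Tate inputs.  The tree END
`Three.KolyvaginOrder.card_sha_three_primary_le_of_classX11b_of_kodairaNeron_rat_index_of_localDuality`
with `hPT`, `hrec`, `hCM`, `h53` SUPPLIED by the tree theorems; binders/conclusion otherwise
VERBATIM.  This is the `hB` binder (`Kolyvagin1990_padicValNat_card_sha_le`) of
`bsdp_of_classX11b_three_of_onTreeInputs` at the prime `3` for the `3`-primary part, MODULO {`hγ`} +
`hN` + (KN₃)/ℚ + the Cassels–Tate inputs — NOT the fact; nothing booked; no mark.
[cite: McCallumLMS1991, §1 Theorem (Kolyvagin), Lemma 5.1 (p. 303), Cor. 5.6]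
[cite: GrossLMS1991, §2 Prop. 2.1 (2), Thm. 2.2 (2), §3 Prop. 3.7 (2)] [cite: MilneADT2006, Ch. I §6, Thm. 6.13(a)] -/
theorem card_sha_three_primary_le_of_classX11b_of_kodairaNeron_rat_index_of_localDuality [NeZero N]
    [W.IsGloballyMinimal] (hW : ClassX11b W 3) (hN : ∀ [W.IsElliptic], N = W.conductorNorm ℤ)
    (hKN3m : ∀ [W.IsElliptic] (v : HeightOneSpectrum (𝓞 ℚ)),
      W.HasMultiplicativeReductionAt v → ¬ 3 ∣ W.ordMinimalDiscriminant v)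
    (hKN3a : ∀ [W.IsElliptic] (v : HeightOneSpectrum (𝓞 ℚ)), W.HasAdditiveReductionAt v →
      W.kodairaSymbolAt v ≠ KodairaSymbol.IV ∧ W.kodairaSymbolAt v ≠ KodairaSymbol.IVstar)
    (hγ : ∀ [W.IsElliptic] (_hK : IsImaginaryQuadratic K) (_hH : SatisfiesHeegnerHypothesis N K)
      (Dt : ModularParametrizationData W N) (β : ℤ) (ι : K →+* ℂ) {M : ℕ}
      (_hM : 1 ≤ M) {n : ℕ} (_hn : Squarefree n)
      (_hKol : ∀ q ∈ n.primeFactors, IsKolyvaginPrime N W K 3 q ∧ FrobEqFrobInfty W K (3 ^ M) q)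
      (d : (m : ℕ) → m ∣ n → KolyvaginHeegnerData Dt β ι m)
      (m : ℕ) (hm : m ∣ n) (ℓ : ℕ) (hℓ : ℓ ∈ m.primeFactors) [Fact ℓ.Prime]
      (hΔ : ¬ (ℓ : ℤ) ∣ minimalDiscriminantInt W) (φ₀ : absoluteGaloisGroup (ZMod ℓ)),
      (∀ x : AlgebraicClosure (ZMod ℓ), φ₀ • x = x ^ ℓ) →
      ∀ (hle : ringClassField K ι (m / ℓ) ≤ ringClassField K ι m)
        (γ : ringClassField K ι m ≃ₐ[ℚ] ringClassField K ι m), γ ∈ ringClassGal ι m →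
        geomReduction hΔ ((RatClosure.pointsEquiv (K := K) W).symm
            ((d m hm).toGeomPoints (pointGalHom W (ringClassField K ι m) γ (d m hm).y))) =
          φ₀ • geomReduction hΔ ((RatClosure.pointsEquiv (K := K) W).symm
            ((d m hm).toGeomPoints (pointGalHom W (ringClassField K ι m) γ
              (WeierstrassCurve.Affine.Point.map (W' := W)
                ((RingClassField.inclusion ι hle).restrictScalars ℚ)
                (d (m / ℓ)
                  ((Nat.div_dvd_of_dvd (Nat.dvd_of_mem_primeFactors hℓ)).trans hm)).y))))) :
    ∀ [W.IsElliptic] (_hK : IsImaginaryQuadratic K) (_hH : SatisfiesHeegnerHypothesis N K)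
      {P : (W.baseChange K).toAffine.Point} (_hP : IsHeegnerPoint N W K P)
      (_hnt : ¬ IsOfFinAddOrder P) (_hidx : (AddSubgroup.zmultiples P).index ≠ 0)
      {M₀ : ℕ} (_hv : padicValNat 3 (AddSubgroup.zmultiples P).index = M₀) [NeZero (3 ^ M₀)]
      {c : K ≃ₐ[ℚ] K} (_hc : c ≠ 1) (_hcc : c * c = 1)
      (e : geomTorsion (W.baseChange K) ((3 ^ M₀ * 3 ^ M₀ : ℕ) : ℤ) →
        geomTorsion (W.baseChange K) ((3 ^ M₀ * 3 ^ M₀ : ℕ) : ℤ) → AlgebraicClosure K)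
      (hμ : ∀ S T, e S T ^ (3 ^ M₀ * 3 ^ M₀) = 1)
      (hadd₁ : ∀ S₁ S₂ T, e (S₁ + S₂) T = e S₁ T * e S₂ T)
      (hadd₂ : ∀ S T₁ T₂, e S (T₁ + T₂) = e S T₁ * e S T₂)
      (hgal : ∀ (σ : absoluteGaloisGroup K) (S T : geomTorsion (W.baseChange K) ((3 ^ M₀ * 3 ^ M₀ : ℕ) : ℤ)),
        σ • e S T = e (σ • S) (σ • T))
      (halt : ∀ T, e T T = 1) (hnondeg : ∀ T, (∀ S, e S T = 1) → T = 0)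
      (inv : LocalInvariants K (3 ^ M₀ * 3 ^ M₀)) (hPT' : inv.SumInvLocalizationEqZero)
      (hinv : ∀ v : HeightOneSpectrum (𝓞 K), Injective (inv (Sum.inr v)))
      (hH3 : ∀ x : galoisCohomology (mu K (3 ^ M₀ * 3 ^ M₀)) 3,
        (∀ v : Place K, galoisCohomology.localization (mu K (3 ^ M₀ * 3 ^ M₀)) v 3 x = 0) → x = 0)
      (hB : Literature.GroupTheory.FiniteAbelian.IsLevelPairing (3 ^ M₀)
        (ctLevelPairing (W.baseChange K) (3 ^ M₀) e hμ hadd₁ hadd₂ hgal inv halt hPT' hH3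
          (localTerm_finite_support (W := W.baseChange K) (m := 3 ^ M₀) (e := e) (hμ := hμ)
            (hadd₁ := hadd₁) (hadd₂ := hadd₂) (hgal := hgal) halt inv)))
      (hPτ : ∀ z ∈ selmerGroup (W.baseChange K) ((3 ^ M₀ * 3 ^ M₀ : ℕ) : ℤ),
        ∀ t ∈ selmerGroup (W.baseChange K) ((3 ^ M₀ * 3 ^ M₀ : ℕ) : ℤ),
        ctGeneralFun (W.baseChange K) (3 ^ M₀) e hμ hadd₁ hadd₂ hgal inv
            (torsionH1ToH1 (W.baseChange K) _ (conjAct W c _ z))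
            (torsionH1ToH1 (W.baseChange K) _ (conjAct W c _ t)) =
          ctGeneralFun (W.baseChange K) (3 ^ M₀) e hμ hadd₁ hadd₂ hgal inv
            (torsionH1ToH1 (W.baseChange K) _ z) (torsionH1ToH1 (W.baseChange K) _ t)),
      Finite (AddCommGroup.primaryComponent (W.baseChange K).sha 3) ∧
      (∀ c ∈ AddCommGroup.primaryComponent (W.baseChange K).sha 3, 3 ^ M₀ • c = 0) ∧
      Nat.card (AddCommGroup.primaryComponent (W.baseChange K).sha 3) ≤ 3 ^ (2 * M₀) ∧
      padicValNat 3 (Nat.card (AddCommGroup.primaryComponent (W.baseChange K).sha 3)) ≤ 2 * M₀ :=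
  Three.KolyvaginOrder.card_sha_three_primary_le_of_classX11b_of_kodairaNeron_rat_index_of_localDuality
    hW
    (poitouTate_sum_localTatePairing_eq_zero_holds K) hN
    (heegnerPointOfConductor_one_galoisConj_holds N W K) (KolyvaginLeaves.hCM_holds N W K 3)
    (@fun _ ↦ KolyvaginLeaves.h53_holds hN 3) hKN3m hKN3a hγ

end Summit.BirchSwinnertonDyer.Rank1Residual.X11b.Three.KolyvaginDischarged

end
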